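import Literature.NumberTheory.Rogawski1990.AdelicStableOrbitalIntegrableG2OfKConj
import Literature.NumberTheory.Rogawski1990.AdelicClassOrbitalIntegralFiniteSupportG2
import HarnessLib

/-!
# The class orbital integrals on `𝒞_𝐀(γ₀) ⊂ ConjClasses U(H₂)(𝐀)` are FINITELY SUPPORTED at the RELATIVE `K_v`-conjugacy clause, hence at every
# SPLIT SEMISIMPLE class — the regularity-free twin of ★ `AdelicClassOrbitalIntegralFiniteSupportG2` (Rogawski 1990, §4.3 p. 44; §5.4 (5.4.2)–(5.4.3) pp. 72–73)

Topic `NumberTheory/Rogawski1990`; namespace `Literature.NumberTheory.Rogawski1990`; **THEOREMS ONLY** (no definition, no named fact, no instance, no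
notation, no `sorry`).  Cell `pub/hodgecm-mathlib`, ENGINE T1 (crux H413 = `stmt-HodgeConjecture-24833`), row O7 «singular semisimple classes», piece
**(D1-s) FILE 2** (O7 OWNER WORD #16): the hypothesis `hfin : (𝒞_𝐀(γ₀) ∩ support Φ_m(·, f)).Finite` of ★ `PreStabilisationCountSelf` ∕ ★ (D1-s) FILE 1
`MatchingAdeleG₂.stableOrbitalSum_map_toAdelic_eq_half_of_singularObs`, DISCHARGED for the kit's restricted-product family `ofLocalAdelic L 3 H₂ mq mqi` and an
`IsTest` pure tensor WITHOUT the regularity of `γ₀` — the proof of ★ `MatchingAdeleG₂.finite_classes_inter_support_classOrbitalIntegral_ofLocalAdelic`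
(F0P3a-p01, regular) with ★ G2-kernel A's regular dictionary replaced by ★ p08's relative-clause dictionary `…_of_eventuallyKConj`
(`AdelicStableClassesProductG2OfKConj`) and the finite supports at `v ∈ S` ∕ `∞` from CLOSED orbits (★ ζ1 `finite_support_classOrbitalIntegral_inter_corresponds_local₂ ∕ arch₂_of_isClosed`),
the unit factors from ★ K6-β-s `eventually_classOrbitalIntegral_indicator_eq_one_of_integralConj`; then the split-semisimple dress of ★ ζ1′ (`hKrel`, `hO`, `hOi`
discharged by ★ K6-α ∕ ε1 ∕ ε2 ∕ ε∞) and the `hFi`-free edition over ★ ζ1″ `MatchingAdeleG₂.integrable_descConj_ofLocalAdelic_of_mem_classes_of_eventuallyKConj`.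

* §1 **`MatchingAdeleG₂.finite_classes_inter_support_of_factor_of_eventuallyKConj`** — pair-level twin of ★ `MatchingAdeleG₂.finite_classes_inter_support_of_factor`
  (generic class function `Φ`, finset-form factorisation hypotheses VERBATIM, `hKrel` replacing `IsRegularElt γ₀`).
* §2 **`MatchingAdeleG₂.finite_classes_inter_support_classOrbitalIntegral_ofLocalAdelic_of_eventuallyKConj`** — at `ofLocalAdelic mq mqi`, `T.eval`; binders = ★ ζ1
  `MatchingAdeleG₂.exists_isEulerOnClasses_ofLocalAdelic_of_eventuallyKConj` VERBATIM (incl. `hFi`); **`…_of_eventuallyKConj'`** — `hFi` DISCHARGED by ★ ζ1″.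
* §3 **`MatchingAdeleG₂.finite_classes_inter_support_classOrbitalIntegral_ofLocalAdelic_of_mul_sub_eq_zero`** — split semisimple `γ₀`, kit-side binders only
  (= ★ ζ1″ `MatchingAdeleG₂.exists_forall_isEulerOnClasses_ofLocalAdelic_of_mul_sub_eq_zero`'s binders VERBATIM: `hH₂ hdet hγ hab hγab mq mqi hadm hadmA hnormγ hnorm T hT`).

HONEST LABEL: nothing printed is consumed; HC_CM is proved only modulo the printed citations until rung 0 closes.

## References
* [Rogawski1990] J. D. Rogawski, *Automorphic Representations of Unitary Groups in Three Variables*, Ann. of Math. Stud. 123 (1990), §3.3 p. 21, §4.1 (4.1.1) p. 39,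
  §4.3 p. 44, §5.4 (5.4.2)–(5.4.3) pp. 72–73.
* [Kottwitz1986] R. E. Kottwitz, *Stable trace formula: elliptic singular terms*, Math. Ann. 275 (1986), Prop. 7.1, Cor. 7.3.
-/

set_option autoImplicit false

noncomputable section

open NumberField IsDedekindDomain Filter Function MeasureTheory
open scoped Matrix MatrixGroups

namespace Literature.NumberTheory.Rogawski1990

open Literature.NumberTheory.Automorphic Literature.LinearAlgebra.Matrix Literature.MeasureTheory.Group
open Literature.AlgebraicGeometry.ShimuraVarieties (unitaryGroup hermForm)

/-! ## §1 Generic class function: finite support from a finset-form factorisation, relative clause -/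

section Carrier

variable {L : Type} [Field L] [NumberField L] [IsCMField L] {H₁ H₂ : Matrix (Fin 3) (Fin 3) L}
  {γ₀ : (UnitaryGroup.cmDatum L 3 H₁).Rational} {γ : (UnitaryGroup.cmDatum L 3 H₂).Rational}

/-- **Finite support on `𝒞_𝐀(γ₀)` from a finset-form factorisation, AT THE RELATIVE CLAUSE** — ★ `MatchingAdeleG₂.finite_classes_inter_support_of_factor` with
`(hH₂ hdet hreg)` replaced by the relative `K_v`-conjugacy clause `hKrel` (dictionary: inj = ★ `eq_of_forall_map_toLocal_eq_of_map_archPart_eq_of_eventuallyKConj`,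
img = ★ `corresponds_out_map_toLocal ∕ _archPart`, ev = ★ `eventually_map_toLocal_eq_mk_of_eventuallyKConj`), every other hypothesis VERBATIM.
[cite: Rogawski1990, §4.3 p. 44; §5.4 (5.4.2)–(5.4.3) pp. 72–73] [cite: Kottwitz1986, Prop. 7.1] -/
theorem MatchingAdeleG₂.finite_classes_inter_support_of_factor_of_eventuallyKConj
    (hKrel : ∀ᶠ v in cofinite, ∀ g g' : (UnitaryGroup.cmDatum L 3 H₂).Local v,
      g ∈ UnitaryGroup.cmLocalIntegralLevel L 3 H₂ v → g' ∈ UnitaryGroup.cmLocalIntegralLevel L 3 H₂ v →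
        Corresponds (UnitaryGroup.conjLocal L (IsCMField.complexConj L) v) ((UnitaryGroup.adelicForm L 3 H₁).map (UnitaryGroup.adeleToLocal L v))
          ((UnitaryGroup.adelicForm L 3 H₂).map (UnitaryGroup.adeleToLocal L v)) ((UnitaryGroup.cmDatum L 3 H₁).toLocal v ((UnitaryGroup.cmDatum L 3 H₁).toAdelic γ₀)) g →
        Corresponds (UnitaryGroup.conjLocal L (IsCMField.complexConj L) v) ((UnitaryGroup.adelicForm L 3 H₁).map (UnitaryGroup.adeleToLocal L v))
          ((UnitaryGroup.adelicForm L 3 H₂).map (UnitaryGroup.adeleToLocal L v)) ((UnitaryGroup.cmDatum L 3 H₁).toLocal v ((UnitaryGroup.cmDatum L 3 H₁).toAdelic γ₀)) g' →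
          ∃ k ∈ UnitaryGroup.cmLocalIntegralLevel L 3 H₂ v, k * g * k⁻¹ = g')
    (hγ : Corresponds (cmConjRingHom L) H₁ H₂ γ₀ γ)
    (Φ : ConjClasses (UnitaryGroup.cmDatum L 3 H₂).Adelic → ℂ)
    (φ : ∀ v : HeightOneSpectrum (𝓞 ↥(maximalRealSubfield L)), ConjClasses ((UnitaryGroup.cmDatum L 3 H₂).Local v) → ℂ)
    (φₐ : ConjClasses (UnitaryGroup.arch (↥(maximalRealSubfield L)) L (IsCMField.complexConj L) 3 H₂) → ℂ)
    (S : Finset (HeightOneSpectrum (𝓞 ↥(maximalRealSubfield L))))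
    (hfac : ∀ c ∈ MatchingAdeleG₂.classes L H₁ H₂ γ₀, ∃ S₂ : Finset (HeightOneSpectrum (𝓞 ↥(maximalRealSubfield L))),
      (∀ v ∉ S₂, φ v (ConjClasses.mk ((UnitaryGroup.cmDatum L 3 H₂).toLocal v (Quotient.out c))) = 1) ∧
      Φ c = φₐ (ConjClasses.mk (UnitaryGroup.archPart (↥(maximalRealSubfield L)) L (IsCMField.complexConj L) 3 H₂ (Quotient.out c))) *
        ∏ v ∈ S₂, φ v (ConjClasses.mk ((UnitaryGroup.cmDatum L 3 H₂).toLocal v (Quotient.out c))))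
    (h1 : ∀ v ∉ S, φ v (ConjClasses.mk ((UnitaryGroup.cmDatum L 3 H₂).toLocal v ((UnitaryGroup.cmDatum L 3 H₂).toAdelic γ))) = 1)
    (h0 : ∀ v ∉ S, ∀ d, Corresponds (UnitaryGroup.conjLocal L (IsCMField.complexConj L) v)
        ((UnitaryGroup.adelicForm L 3 H₁).map (UnitaryGroup.adeleToLocal L v))
        ((UnitaryGroup.adelicForm L 3 H₂).map (UnitaryGroup.adeleToLocal L v))
        ((UnitaryGroup.cmDatum L 3 H₁).toLocal v ((UnitaryGroup.cmDatum L 3 H₁).toAdelic γ₀)) (Quotient.out d) →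
      d ≠ ConjClasses.mk ((UnitaryGroup.cmDatum L 3 H₂).toLocal v ((UnitaryGroup.cmDatum L 3 H₂).toAdelic γ)) → φ v d = 0)
    (hfin : ∀ v ∈ S, (support (φ v) ∩ {d | Corresponds (UnitaryGroup.conjLocal L (IsCMField.complexConj L) v)
        ((UnitaryGroup.adelicForm L 3 H₁).map (UnitaryGroup.adeleToLocal L v))
        ((UnitaryGroup.adelicForm L 3 H₂).map (UnitaryGroup.adeleToLocal L v))
        ((UnitaryGroup.cmDatum L 3 H₁).toLocal v ((UnitaryGroup.cmDatum L 3 H₁).toAdelic γ₀)) (Quotient.out d)}).Finite)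
    (hfinₐ : (support φₐ ∩ {b | Corresponds (UnitaryGroup.conjMixed (↥(maximalRealSubfield L)) L (IsCMField.complexConj L)) (UnitaryGroup.archFormOf L 3 H₁)
        (UnitaryGroup.archFormOf L 3 H₂) (cmRationalToArch L 3 H₁ γ₀) (Quotient.out b)}).Finite) :
    (MatchingAdeleG₂.classes L H₁ H₂ γ₀ ∩ support Φ).Finite := by
  classical
  refine finite_inter_support_of_factor (MatchingAdeleG₂.classes L H₁ H₂ γ₀)
    (fun c v => ConjClasses.map ((UnitaryGroup.cmDatum L 3 H₂).toLocal v) c)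
    (fun c => ConjClasses.map (UnitaryGroup.archPart (↥(maximalRealSubfield L)) L (IsCMField.complexConj L) 3 H₂) c)
    (fun v => {d | Corresponds (UnitaryGroup.conjLocal L (IsCMField.complexConj L) v)
        ((UnitaryGroup.adelicForm L 3 H₁).map (UnitaryGroup.adeleToLocal L v))
        ((UnitaryGroup.adelicForm L 3 H₂).map (UnitaryGroup.adeleToLocal L v))
        ((UnitaryGroup.cmDatum L 3 H₁).toLocal v ((UnitaryGroup.cmDatum L 3 H₁).toAdelic γ₀)) (Quotient.out d)})
    (fun v => ConjClasses.mk ((UnitaryGroup.cmDatum L 3 H₂).toLocal v ((UnitaryGroup.cmDatum L 3 H₂).toAdelic γ)))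
    _ Φ φ φₐ S ?_ ?_ ?_ (fun c hc => ?_) h1 (fun v hv d hd hne => h0 v hv d hd hne) hfin hfinₐ
  · -- (inj) the gluing, relative clause
    intro c hc c' hc' h
    exact MatchingAdeleG₂.eq_of_forall_map_toLocal_eq_of_map_archPart_eq_of_eventuallyKConj hKrel hc hc' (fun v => congrFun (congrArg Prod.fst h) v)
      (congrArg Prod.snd h)
  · -- (img)
    exact fun c hc => ⟨fun v => MatchingAdeleG₂.corresponds_out_map_toLocal hc v, MatchingAdeleG₂.corresponds_out_map_archPart hc⟩
  · -- (ev) [Kt₄] 7.1, relative clause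
    exact fun c hc => MatchingAdeleG₂.eventually_map_toLocal_eq_mk_of_eventuallyKConj hKrel hγ hc
  · -- (fac) the finset-form factorisation read as a `finprod`
    obtain ⟨S₂, hS₂, hc'⟩ := hfac c hc
    rw [hc', conjClasses_map_eq_mk_out]
    congr 1
    simp_rw [conjClasses_map_eq_mk_out]
    refine (finprod_eq_prod_of_mulSupport_subset _ fun v hv => ?_).symm
    rw [Finset.mem_coe]
    by_contra hvS
    exact hv (hS₂ v hvS)

end Carrier

/-! ## §2 At the kit's family `ofLocalAdelic L 3 H₂ mq mqi` and an `IsTest` pure tensor, relative clause -/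

section OfLocalAdelic

variable {L : Type} [Field L] [NumberField L] [IsCMField L] {H₁ H₂ : Matrix (Fin 3) (Fin 3) L}
  {γ₀ : (UnitaryGroup.cmDatum L 3 H₁).Rational} {γ : (UnitaryGroup.cmDatum L 3 H₂).Rational}
  [∀ g : (UnitaryGroup.cmDatum L 3 H₂).Adelic,
    MeasurableSpace ((UnitaryGroup.cmDatum L 3 H₂).Adelic ⧸ Subgroup.centralizer ({g} : Set (UnitaryGroup.cmDatum L 3 H₂).Adelic))]
  [∀ g : (UnitaryGroup.cmDatum L 3 H₂).Adelic,
    BorelSpace ((UnitaryGroup.cmDatum L 3 H₂).Adelic ⧸ Subgroup.centralizer ({g} : Set (UnitaryGroup.cmDatum L 3 H₂).Adelic))]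
  [∀ (v : HeightOneSpectrum (𝓞 ↥(maximalRealSubfield L))) (x : (UnitaryGroup.cmDatum L 3 H₂).Local v),
    MeasurableSpace ((UnitaryGroup.cmDatum L 3 H₂).Local v ⧸ Subgroup.centralizer ({x} : Set ((UnitaryGroup.cmDatum L 3 H₂).Local v)))]
  [∀ (v : HeightOneSpectrum (𝓞 ↥(maximalRealSubfield L))) (x : (UnitaryGroup.cmDatum L 3 H₂).Local v),
    BorelSpace ((UnitaryGroup.cmDatum L 3 H₂).Local v ⧸ Subgroup.centralizer ({x} : Set ((UnitaryGroup.cmDatum L 3 H₂).Local v)))]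
  [∀ a : UnitaryGroup.arch (↥(maximalRealSubfield L)) L (IsCMField.complexConj L) 3 H₂,
    MeasurableSpace (UnitaryGroup.arch (↥(maximalRealSubfield L)) L (IsCMField.complexConj L) 3 H₂ ⧸
      Subgroup.centralizer ({a} : Set (UnitaryGroup.arch (↥(maximalRealSubfield L)) L (IsCMField.complexConj L) 3 H₂)))]
  [∀ a : UnitaryGroup.arch (↥(maximalRealSubfield L)) L (IsCMField.complexConj L) 3 H₂,
    BorelSpace (UnitaryGroup.arch (↥(maximalRealSubfield L)) L (IsCMField.complexConj L) 3 H₂ ⧸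
      Subgroup.centralizer ({a} : Set (UnitaryGroup.arch (↥(maximalRealSubfield L)) L (IsCMField.complexConj L) 3 H₂)))]

/-- **`(𝒞_𝐀(γ₀) ∩ support Φ_{ofLocalAdelic mq mqi}(·, T.eval)).Finite` AT THE RELATIVE CLAUSE (no regularity)** — binders = ★ ζ1
`MatchingAdeleG₂.exists_isEulerOnClasses_ofLocalAdelic_of_eventuallyKConj` VERBATIM (`hKrel`; `mq v`, `mqi` admissible on the classes corresponding to `(γ₀)_v` ∕ `γ₀ ⊗ 1`;
closed `GL₃`-orbits `hO`, `hOi`; `mq` normalised at `toAdelic γ` and at every matching adèle; `T` an `IsTest` pure tensor with integrable orbital integrands on `𝒞_𝐀(γ₀)`):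
§1 fed with ζ1's own five families — (fac) ★ C3 `classOrbitalIntegral_ofLocalAdelic_eval_eq_mul_prod` per class, (h1) ★ K6-β-s unit factors at `[γ_v]` off a finite set,
(h0) ★ `classOrbitalIntegral_indicator_eq_zero_of_corresponds_of_ne₂` off the clause's bad set, (hfin)(hfinₐ) ★ `finite_support_classOrbitalIntegral_inter_corresponds_local₂ ∕ arch₂_of_isClosed`.
[cite: Rogawski1990, §4.3 p. 44; §5.4 (5.4.2)–(5.4.3) pp. 72–73] [cite: Kottwitz1986, Prop. 7.1, Cor. 7.3] -/
theorem MatchingAdeleG₂.finite_classes_inter_support_classOrbitalIntegral_ofLocalAdelic_of_eventuallyKConj (hH₂ : (H₂.map (cmConjRingHom L))ᵀ = H₂)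
    (hdet : H₂.det ≠ 0) (hγ : Corresponds (cmConjRingHom L) H₁ H₂ γ₀ γ)
    (hKrel : ∀ᶠ v in cofinite, ∀ g g' : (UnitaryGroup.cmDatum L 3 H₂).Local v,
      g ∈ UnitaryGroup.cmLocalIntegralLevel L 3 H₂ v → g' ∈ UnitaryGroup.cmLocalIntegralLevel L 3 H₂ v →
        Corresponds (UnitaryGroup.conjLocal L (IsCMField.complexConj L) v) ((UnitaryGroup.adelicForm L 3 H₁).map (UnitaryGroup.adeleToLocal L v))
          ((UnitaryGroup.adelicForm L 3 H₂).map (UnitaryGroup.adeleToLocal L v)) ((UnitaryGroup.cmDatum L 3 H₁).toLocal v ((UnitaryGroup.cmDatum L 3 H₁).toAdelic γ₀)) g →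
        Corresponds (UnitaryGroup.conjLocal L (IsCMField.complexConj L) v) ((UnitaryGroup.adelicForm L 3 H₁).map (UnitaryGroup.adeleToLocal L v))
          ((UnitaryGroup.adelicForm L 3 H₂).map (UnitaryGroup.adeleToLocal L v)) ((UnitaryGroup.cmDatum L 3 H₁).toLocal v ((UnitaryGroup.cmDatum L 3 H₁).toAdelic γ₀)) g' →
          ∃ k ∈ UnitaryGroup.cmLocalIntegralLevel L 3 H₂ v, k * g * k⁻¹ = g')
    (mq : ∀ v : HeightOneSpectrum (𝓞 ↥(maximalRealSubfield L)), OrbitalMeasureFamily ((UnitaryGroup.cmDatum L 3 H₂).Local v))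
    (mqi : OrbitalMeasureFamily (UnitaryGroup.arch (↥(maximalRealSubfield L)) L (IsCMField.complexConj L) 3 H₂))
    (hadm : ∀ v, (mq v).IsAdmissibleOn fun x : (UnitaryGroup.cmDatum L 3 H₂).Local v =>
      Corresponds (UnitaryGroup.conjLocal L (IsCMField.complexConj L) v)
        ((UnitaryGroup.adelicForm L 3 H₁).map (UnitaryGroup.adeleToLocal L v))
        ((UnitaryGroup.adelicForm L 3 H₂).map (UnitaryGroup.adeleToLocal L v))
        ((UnitaryGroup.cmDatum L 3 H₁).toLocal v ((UnitaryGroup.cmDatum L 3 H₁).toAdelic γ₀)) x)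
    (hadmA : mqi.IsAdmissibleOn fun a : UnitaryGroup.arch (↥(maximalRealSubfield L)) L (IsCMField.complexConj L) 3 H₂ =>
      Corresponds (UnitaryGroup.conjMixed (↥(maximalRealSubfield L)) L (IsCMField.complexConj L)) (UnitaryGroup.archFormOf L 3 H₁)
        (UnitaryGroup.archFormOf L 3 H₂) (cmRationalToArch L 3 H₁ γ₀) a)
    (hO : ∀ v : HeightOneSpectrum (𝓞 ↥(maximalRealSubfield L)),
      IsClosed {x : GL (Fin 3) (UnitaryGroup.LocalRing L v) | ∃ g : GL (Fin 3) (UnitaryGroup.LocalRing L v),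
        g * (((UnitaryGroup.cmDatum L 3 H₂).toLocal v ((UnitaryGroup.cmDatum L 3 H₂).toAdelic γ)).val :
          GL (Fin 3) (UnitaryGroup.LocalRing L v)) * g⁻¹ = x})
    (hOi : IsClosed {x : GL (Fin 3) (mixedEmbedding.mixedSpace L) | ∃ g : GL (Fin 3) (mixedEmbedding.mixedSpace L),
        g * ((cmRationalToArch L 3 H₂ γ).val : GL (Fin 3) (mixedEmbedding.mixedSpace L)) * g⁻¹ = x})
    (hnormγ : ∃ S₀ : Finset (HeightOneSpectrum (𝓞 ↥(maximalRealSubfield L))),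
      UnitaryGroup.IsNormalisedOff L 3 H₂ mq ((UnitaryGroup.cmDatum L 3 H₂).toAdelic γ) S₀)
    (hnorm : ∀ p : MatchingAdeleG₂ L H₁ H₂ γ₀, ∃ S₀ : Finset (HeightOneSpectrum (𝓞 ↥(maximalRealSubfield L))),
      UnitaryGroup.IsNormalisedOff L 3 H₂ mq p.adele S₀)
    (T : UnitaryGroup.PureTensor L 3 H₂) (hT : T.IsTest)
    (hFi : ∀ c ∈ MatchingAdeleG₂.classes L H₁ H₂ γ₀, Integrable
      (descConj (Quotient.out c : (UnitaryGroup.cmDatum L 3 H₂).Adelic)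
        (Subgroup.centralizer ({(Quotient.out c : (UnitaryGroup.cmDatum L 3 H₂).Adelic)} : Set (UnitaryGroup.cmDatum L 3 H₂).Adelic))
        (centralizer_comm _) T.eval)
      (UnitaryGroup.OrbitalMeasureFamily.ofLocalAdelic L 3 H₂ mq mqi c)) :
    (MatchingAdeleG₂.classes L H₁ H₂ γ₀ ∩
      support fun δ => classOrbitalIntegral (UnitaryGroup.OrbitalMeasureFamily.ofLocalAdelic L 3 H₂ mq mqi) T.eval δ).Finite := by
  classical
  -- admissibility triples at a local point corresponding to `(γ₀)_v`
  have hadmAt : ∀ v (x : (UnitaryGroup.cmDatum L 3 H₂).Local v),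
      Corresponds (UnitaryGroup.conjLocal L (IsCMField.complexConj L) v)
        ((UnitaryGroup.adelicForm L 3 H₁).map (UnitaryGroup.adeleToLocal L v))
        ((UnitaryGroup.adelicForm L 3 H₂).map (UnitaryGroup.adeleToLocal L v))
        ((UnitaryGroup.cmDatum L 3 H₁).toLocal v ((UnitaryGroup.cmDatum L 3 H₁).toAdelic γ₀)) x →
      mq v (ConjClasses.mk x) ≠ 0 ∧ SMulInvariantMeasure _ _ (mq v (ConjClasses.mk x)) ∧ IsFiniteMeasureOnCompacts (mq v (ConjClasses.mk x)) :=
    fun v x hx => hadm v (ConjClasses.mk x) (hx.of_isStablyConj_right (isStablyConj_of_isConj (isConj_out_conjClasses_mk x)))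
  -- (1) the clause made absolute at the integral base point `γ_v`
  have hKCev : ∀ᶠ v in cofinite, ∀ g : (UnitaryGroup.cmDatum L 3 H₂).Local v,
      g ∈ UnitaryGroup.cmLocalIntegralLevel L 3 H₂ v →
      Corresponds (UnitaryGroup.conjLocal L (IsCMField.complexConj L) v)
          ((UnitaryGroup.adelicForm L 3 H₁).map (UnitaryGroup.adeleToLocal L v))
          ((UnitaryGroup.adelicForm L 3 H₂).map (UnitaryGroup.adeleToLocal L v))
          ((UnitaryGroup.cmDatum L 3 H₁).toLocal v ((UnitaryGroup.cmDatum L 3 H₁).toAdelic γ₀)) g →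
        ∃ k ∈ UnitaryGroup.cmLocalIntegralLevel L 3 H₂ v,
          k * (UnitaryGroup.cmDatum L 3 H₂).toLocal v ((UnitaryGroup.cmDatum L 3 H₂).toAdelic γ) * k⁻¹ = g := by
    filter_upwards [hKrel,
      eventually_toLocal_mem_cmLocalIntegralLevel ((UnitaryGroup.cmDatum L 3 H₂).toAdelic γ)] with v hv hγint g hg hcg
    exact hv _ g hγint hg (corresponds_toLocal_toAdelic hγ v) hcg
  have hKfin := Filter.eventually_cofinite.1 hKCev
  -- (2) the unit-factor places at the base class `[γ_v]` (★ K6-β-s at `H₂`)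
  obtain ⟨S₀γ, hS₀γ⟩ := hnormγ
  have hunit := UnitaryGroup.eventually_classOrbitalIntegral_indicator_eq_one_of_integralConj L 3 H₂ mq γ
    (MatchingAdeleG₂.isConj_toLocal_of_eventuallyKConj hKrel hγ)
    (fun v => (hadmAt v _ (corresponds_toLocal_toAdelic hγ v)).2.1) hS₀γ
  have hUfin := Filter.eventually_cofinite.1 hunit
  -- the finite exceptional set
  let S : Finset (HeightOneSpectrum (𝓞 ↥(maximalRealSubfield L))) := T.S ∪ hKfin.toFinset ∪ hUfin.toFinset
  have hS_T : ∀ v ∉ S, v ∉ T.S := fun v hv h => hv (Finset.mem_union_left _ (Finset.mem_union_left _ h))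
  have hS_K : ∀ v ∉ S, ∀ g : (UnitaryGroup.cmDatum L 3 H₂).Local v,
      g ∈ UnitaryGroup.cmLocalIntegralLevel L 3 H₂ v →
      Corresponds (UnitaryGroup.conjLocal L (IsCMField.complexConj L) v)
          ((UnitaryGroup.adelicForm L 3 H₁).map (UnitaryGroup.adeleToLocal L v))
          ((UnitaryGroup.adelicForm L 3 H₂).map (UnitaryGroup.adeleToLocal L v))
          ((UnitaryGroup.cmDatum L 3 H₁).toLocal v ((UnitaryGroup.cmDatum L 3 H₁).toAdelic γ₀)) g →
        ∃ k ∈ UnitaryGroup.cmLocalIntegralLevel L 3 H₂ v,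
          k * (UnitaryGroup.cmDatum L 3 H₂).toLocal v ((UnitaryGroup.cmDatum L 3 H₂).toAdelic γ) * k⁻¹ = g := by
    intro v hv
    by_contra hnot
    exact hv (Finset.mem_union_left _ (Finset.mem_union_right _ (hKfin.mem_toFinset.2 hnot)))
  have hS_U : ∀ v ∉ S, classOrbitalIntegral (mq v)
      ((UnitaryGroup.cmLocalIntegralLevel L 3 H₂ v : Set ((UnitaryGroup.cmDatum L 3 H₂).Local v)).indicator fun _ => (1 : ℂ))
      (ConjClasses.mk ((UnitaryGroup.cmDatum L 3 H₂).toLocal v ((UnitaryGroup.cmDatum L 3 H₂).toAdelic γ))) = 1 := by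
    intro v hv
    by_contra hnot
    exact hv (Finset.mem_union_right _ (hUfin.mem_toFinset.2 hnot))
  refine MatchingAdeleG₂.finite_classes_inter_support_of_factor_of_eventuallyKConj hKrel hγ _ (fun v => classOrbitalIntegral (mq v) (T.loc v))
    (classOrbitalIntegral mqi T.arch) S (fun c hc => ?_) (fun v hv => ?_) (fun v hv d hd hne => ?_) (fun v _ => ?_) ?_
  · -- (fac) ★ C3 at the class `c`, unit factors off `S ∪ {v | local class of c ≠ [γ_v]}`
    obtain ⟨p, rfl⟩ := hc
    let q : MatchingAdeleG₂ L H₁ H₂ γ₀ := p.conj (Quotient.out (ConjClasses.mk p.adele)) (isConj_out_conjClasses_mk p.adele)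
    have hq : q.adele = Quotient.out (ConjClasses.mk p.adele) := rfl
    obtain ⟨S₀, hS₀⟩ := hnorm q
    have hev := MatchingAdeleG₂.eventually_map_toLocal_eq_mk_of_eventuallyKConj hKrel hγ (MatchingAdeleG₂.mk_adele_mem_classes p)
    have hevfin := Filter.eventually_cofinite.1 hev
    have hunitc : ∀ v ∉ S ∪ hevfin.toFinset, classOrbitalIntegral (mq v) (T.loc v)
        (ConjClasses.mk ((UnitaryGroup.cmDatum L 3 H₂).toLocal v (Quotient.out (ConjClasses.mk p.adele)))) = 1 := by
      intro v hv
      have hvS : v ∉ S := fun h => hv (Finset.mem_union_left _ h)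
      have hvE : ConjClasses.map ((UnitaryGroup.cmDatum L 3 H₂).toLocal v) (ConjClasses.mk p.adele) =
          ConjClasses.mk ((UnitaryGroup.cmDatum L 3 H₂).toLocal v ((UnitaryGroup.cmDatum L 3 H₂).toAdelic γ)) := by
        by_contra hnot
        exact hv (Finset.mem_union_right _ (hevfin.mem_toFinset.2 hnot))
      rw [← conjClasses_map_eq_mk_out ((UnitaryGroup.cmDatum L 3 H₂).toLocal v) (ConjClasses.mk p.adele), hvE, (hT.isUnramified).loc_eq (hS_T v hvS)]
      exact hS_U v hvS
    refine ⟨S ∪ hevfin.toFinset, hunitc, ?_⟩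
    rw [hq] at hS₀
    exact UnitaryGroup.classOrbitalIntegral_ofLocalAdelic_eval_eq_mul_prod L 3 _ mq mqi (ConjClasses.mk p.adele) hS₀
      (fun v => hadmAt v _ (by rw [← hq]; exact q.corresponds_toLocal v))
      (hadmA _ (Corresponds.of_isStablyConj_right (by rw [← hq]; exact q.corresponds_arch)
        ((UnitaryGroup.arch (↥(maximalRealSubfield L)) L (IsCMField.complexConj L) 3 H₂).subtype.map_isConj (isConj_out_conjClasses_mk _))))
      T (S ∪ hevfin.toFinset) hT.isUnramified (hFi _ (MatchingAdeleG₂.mk_adele_mem_classes p)) hunitc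
  · -- (h1) the base class has unit factor off `S`
    rw [(hT.isUnramified).loc_eq (hS_T v hv)]
    exact hS_U v hv
  · -- (h0) off `S` the other classes of the local stable class have factor `0`
    rw [(hT.isUnramified).loc_eq (hS_T v hv)]
    exact classOrbitalIntegral_indicator_eq_zero_of_corresponds_of_ne₂ v (hS_K v hv) (mq v) d hd hne
  · -- (hfin)
    exact finite_support_classOrbitalIntegral_inter_corresponds_local₂_of_isClosed hH₂ hdet hγ v (hO v) (mq v)
      (UnitaryGroup.PureTensor.hasCompactSupport_loc hT.isUnramified hT.isFinSmooth v)
  · -- (hfinₐ)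
    exact finite_support_classOrbitalIntegral_inter_corresponds_arch₂_of_isClosed hH₂ hdet hγ hOi mqi hT.isArchTest.hasCompactSupport_arch

/-- **The same with `hFi` DISCHARGED** (★ ζ1″ `MatchingAdeleG₂.integrable_descConj_ofLocalAdelic_of_mem_classes_of_eventuallyKConj`): kit-side binders only —
`hγ`, `hKrel`, class-local admissibility, closed orbits `hO`∕`hOi`, normalisation at `toAdelic γ` and at every matching adèle, an `IsTest` pure tensor.
[cite: Rogawski1990, §4.3 p. 44; §5.4 (5.4.2)–(5.4.3) pp. 72–73] [cite: Kottwitz1986, Prop. 7.1, Cor. 7.3] -/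
theorem MatchingAdeleG₂.finite_classes_inter_support_classOrbitalIntegral_ofLocalAdelic_of_eventuallyKConj' (hH₂ : (H₂.map (cmConjRingHom L))ᵀ = H₂)
    (hdet : H₂.det ≠ 0) (hγ : Corresponds (cmConjRingHom L) H₁ H₂ γ₀ γ)
    (hKrel : ∀ᶠ v in cofinite, ∀ g g' : (UnitaryGroup.cmDatum L 3 H₂).Local v,
      g ∈ UnitaryGroup.cmLocalIntegralLevel L 3 H₂ v → g' ∈ UnitaryGroup.cmLocalIntegralLevel L 3 H₂ v →
        Corresponds (UnitaryGroup.conjLocal L (IsCMField.complexConj L) v) ((UnitaryGroup.adelicForm L 3 H₁).map (UnitaryGroup.adeleToLocal L v))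
          ((UnitaryGroup.adelicForm L 3 H₂).map (UnitaryGroup.adeleToLocal L v)) ((UnitaryGroup.cmDatum L 3 H₁).toLocal v ((UnitaryGroup.cmDatum L 3 H₁).toAdelic γ₀)) g →
        Corresponds (UnitaryGroup.conjLocal L (IsCMField.complexConj L) v) ((UnitaryGroup.adelicForm L 3 H₁).map (UnitaryGroup.adeleToLocal L v))
          ((UnitaryGroup.adelicForm L 3 H₂).map (UnitaryGroup.adeleToLocal L v)) ((UnitaryGroup.cmDatum L 3 H₁).toLocal v ((UnitaryGroup.cmDatum L 3 H₁).toAdelic γ₀)) g' →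
          ∃ k ∈ UnitaryGroup.cmLocalIntegralLevel L 3 H₂ v, k * g * k⁻¹ = g')
    (mq : ∀ v : HeightOneSpectrum (𝓞 ↥(maximalRealSubfield L)), OrbitalMeasureFamily ((UnitaryGroup.cmDatum L 3 H₂).Local v))
    (mqi : OrbitalMeasureFamily (UnitaryGroup.arch (↥(maximalRealSubfield L)) L (IsCMField.complexConj L) 3 H₂))
    (hadm : ∀ v, (mq v).IsAdmissibleOn fun x : (UnitaryGroup.cmDatum L 3 H₂).Local v =>
      Corresponds (UnitaryGroup.conjLocal L (IsCMField.complexConj L) v)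
        ((UnitaryGroup.adelicForm L 3 H₁).map (UnitaryGroup.adeleToLocal L v))
        ((UnitaryGroup.adelicForm L 3 H₂).map (UnitaryGroup.adeleToLocal L v))
        ((UnitaryGroup.cmDatum L 3 H₁).toLocal v ((UnitaryGroup.cmDatum L 3 H₁).toAdelic γ₀)) x)
    (hadmA : mqi.IsAdmissibleOn fun a : UnitaryGroup.arch (↥(maximalRealSubfield L)) L (IsCMField.complexConj L) 3 H₂ =>
      Corresponds (UnitaryGroup.conjMixed (↥(maximalRealSubfield L)) L (IsCMField.complexConj L)) (UnitaryGroup.archFormOf L 3 H₁)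
        (UnitaryGroup.archFormOf L 3 H₂) (cmRationalToArch L 3 H₁ γ₀) a)
    (hO : ∀ v : HeightOneSpectrum (𝓞 ↥(maximalRealSubfield L)),
      IsClosed {x : GL (Fin 3) (UnitaryGroup.LocalRing L v) | ∃ g : GL (Fin 3) (UnitaryGroup.LocalRing L v),
        g * (((UnitaryGroup.cmDatum L 3 H₂).toLocal v ((UnitaryGroup.cmDatum L 3 H₂).toAdelic γ)).val :
          GL (Fin 3) (UnitaryGroup.LocalRing L v)) * g⁻¹ = x})
    (hOi : IsClosed {x : GL (Fin 3) (mixedEmbedding.mixedSpace L) | ∃ g : GL (Fin 3) (mixedEmbedding.mixedSpace L),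
        g * ((cmRationalToArch L 3 H₂ γ).val : GL (Fin 3) (mixedEmbedding.mixedSpace L)) * g⁻¹ = x})
    (hnormγ : ∃ S₀ : Finset (HeightOneSpectrum (𝓞 ↥(maximalRealSubfield L))),
      UnitaryGroup.IsNormalisedOff L 3 H₂ mq ((UnitaryGroup.cmDatum L 3 H₂).toAdelic γ) S₀)
    (hnorm : ∀ p : MatchingAdeleG₂ L H₁ H₂ γ₀, ∃ S₀ : Finset (HeightOneSpectrum (𝓞 ↥(maximalRealSubfield L))),
      UnitaryGroup.IsNormalisedOff L 3 H₂ mq p.adele S₀)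
    (T : UnitaryGroup.PureTensor L 3 H₂) (hT : T.IsTest) :
    (MatchingAdeleG₂.classes L H₁ H₂ γ₀ ∩
      support fun δ => classOrbitalIntegral (UnitaryGroup.OrbitalMeasureFamily.ofLocalAdelic L 3 H₂ mq mqi) T.eval δ).Finite :=
  MatchingAdeleG₂.finite_classes_inter_support_classOrbitalIntegral_ofLocalAdelic_of_eventuallyKConj hH₂ hdet hγ hKrel mq mqi hadm hadmA hO hOi hnormγ
    hnorm T hT fun c hc =>
      MatchingAdeleG₂.integrable_descConj_ofLocalAdelic_of_mem_classes_of_eventuallyKConj hH₂ hdet hγ hKrel hO hOi mq mqi hadm hadmA hnorm T hT c hc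

end OfLocalAdelic

/-! ## §3 At a SPLIT SEMISIMPLE class: kit-side binders only -/

section Semisimple

variable {L : Type} [Field L] [NumberField L] [IsCMField L] {H₁ H₂ : Matrix (Fin 3) (Fin 3) L}
  {γ₀ : (UnitaryGroup.cmDatum L 3 H₁).Rational} {γ : (UnitaryGroup.cmDatum L 3 H₂).Rational}
  [∀ g : (UnitaryGroup.cmDatum L 3 H₂).Adelic,
    MeasurableSpace ((UnitaryGroup.cmDatum L 3 H₂).Adelic ⧸ Subgroup.centralizer ({g} : Set (UnitaryGroup.cmDatum L 3 H₂).Adelic))]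
  [∀ g : (UnitaryGroup.cmDatum L 3 H₂).Adelic,
    BorelSpace ((UnitaryGroup.cmDatum L 3 H₂).Adelic ⧸ Subgroup.centralizer ({g} : Set (UnitaryGroup.cmDatum L 3 H₂).Adelic))]
  [∀ (v : HeightOneSpectrum (𝓞 ↥(maximalRealSubfield L))) (x : (UnitaryGroup.cmDatum L 3 H₂).Local v),
    MeasurableSpace ((UnitaryGroup.cmDatum L 3 H₂).Local v ⧸ Subgroup.centralizer ({x} : Set ((UnitaryGroup.cmDatum L 3 H₂).Local v)))]
  [∀ (v : HeightOneSpectrum (𝓞 ↥(maximalRealSubfield L))) (x : (UnitaryGroup.cmDatum L 3 H₂).Local v),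
    BorelSpace ((UnitaryGroup.cmDatum L 3 H₂).Local v ⧸ Subgroup.centralizer ({x} : Set ((UnitaryGroup.cmDatum L 3 H₂).Local v)))]
  [∀ a : UnitaryGroup.arch (↥(maximalRealSubfield L)) L (IsCMField.complexConj L) 3 H₂,
    MeasurableSpace (UnitaryGroup.arch (↥(maximalRealSubfield L)) L (IsCMField.complexConj L) 3 H₂ ⧸
      Subgroup.centralizer ({a} : Set (UnitaryGroup.arch (↥(maximalRealSubfield L)) L (IsCMField.complexConj L) 3 H₂)))]
  [∀ a : UnitaryGroup.arch (↥(maximalRealSubfield L)) L (IsCMField.complexConj L) 3 H₂,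
    BorelSpace (UnitaryGroup.arch (↥(maximalRealSubfield L)) L (IsCMField.complexConj L) 3 H₂ ⧸
      Subgroup.centralizer ({a} : Set (UnitaryGroup.arch (↥(maximalRealSubfield L)) L (IsCMField.complexConj L) 3 H₂)))]

/-- **`(𝒞_𝐀(γ₀) ∩ support Φ_{ofLocalAdelic mq mqi}(·, T.eval)).Finite` AT A SPLIT SEMISIMPLE CLASS, kit-side binders only** — `γ₀ ∈ U(H₁)(L⁺)` with
`(γ₀ − a)(γ₀ − b) = 0`, `a ≠ b` (every singular semisimple or central element of an anisotropic `U(H₁)`), `γ ∈ U(H₂)(L⁺)` a rational correspondent, `mq v` ∕ `mqi`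
admissible on the classes corresponding to `(γ₀)_v` ∕ `γ₀ ⊗ 1`, `mq` normalised off a finite set at `toAdelic γ` and at every matching adèle, `T` an `IsTest` pure
tensor — §2′ at `hKrel :=` ★ `MatchingAdeleG₂.eventuallyKConj_rel_of_isSemisimpleElt` (semisimplicity of `γ` by ★ ε1 at the transported relation), `hO v :=` ★ ε2,
`hOi :=` ★ ε∞ (exactly the lines of ★ ζ1′∕ζ1″).  Binders = ★ ζ1″ `MatchingAdeleG₂.exists_forall_isEulerOnClasses_ofLocalAdelic_of_mul_sub_eq_zero` VERBATIM; it is the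
`hfin` of ★ (D1-s) FILE 1 at the kit's family. [cite: Rogawski1990, §3.3 p. 21; §3.8 Prop. 3.8.1 p. 27; §4.3 p. 44; §5.4 (5.4.2)–(5.4.3) pp. 72–73] [cite: Kottwitz1986, Prop. 7.1, Cor. 7.3] -/
theorem MatchingAdeleG₂.finite_classes_inter_support_classOrbitalIntegral_ofLocalAdelic_of_mul_sub_eq_zero (hH₂ : (H₂.map (cmConjRingHom L))ᵀ = H₂)
    (hdet : H₂.det ≠ 0) (hγ : Corresponds (cmConjRingHom L) H₁ H₂ γ₀ γ)
    {a b : L} (hab : a ≠ b)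
    (hγab : ((((γ₀ : unitaryGroup (cmConjRingHom L) H₁).val : GL (Fin 3) L).val : Matrix (Fin 3) (Fin 3) L) - a • (1 : Matrix (Fin 3) (Fin 3) L)) *
      ((((γ₀ : unitaryGroup (cmConjRingHom L) H₁).val : GL (Fin 3) L).val : Matrix (Fin 3) (Fin 3) L) - b • (1 : Matrix (Fin 3) (Fin 3) L)) = 0)
    (mq : ∀ v : HeightOneSpectrum (𝓞 ↥(maximalRealSubfield L)), OrbitalMeasureFamily ((UnitaryGroup.cmDatum L 3 H₂).Local v))
    (mqi : OrbitalMeasureFamily (UnitaryGroup.arch (↥(maximalRealSubfield L)) L (IsCMField.complexConj L) 3 H₂))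
    (hadm : ∀ v, (mq v).IsAdmissibleOn fun x : (UnitaryGroup.cmDatum L 3 H₂).Local v =>
      Corresponds (UnitaryGroup.conjLocal L (IsCMField.complexConj L) v)
        ((UnitaryGroup.adelicForm L 3 H₁).map (UnitaryGroup.adeleToLocal L v))
        ((UnitaryGroup.adelicForm L 3 H₂).map (UnitaryGroup.adeleToLocal L v))
        ((UnitaryGroup.cmDatum L 3 H₁).toLocal v ((UnitaryGroup.cmDatum L 3 H₁).toAdelic γ₀)) x)
    (hadmA : mqi.IsAdmissibleOn fun a : UnitaryGroup.arch (↥(maximalRealSubfield L)) L (IsCMField.complexConj L) 3 H₂ =>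
      Corresponds (UnitaryGroup.conjMixed (↥(maximalRealSubfield L)) L (IsCMField.complexConj L)) (UnitaryGroup.archFormOf L 3 H₁)
        (UnitaryGroup.archFormOf L 3 H₂) (cmRationalToArch L 3 H₁ γ₀) a)
    (hnormγ : ∃ S₀ : Finset (HeightOneSpectrum (𝓞 ↥(maximalRealSubfield L))),
      UnitaryGroup.IsNormalisedOff L 3 H₂ mq ((UnitaryGroup.cmDatum L 3 H₂).toAdelic γ) S₀)
    (hnorm : ∀ p : MatchingAdeleG₂ L H₁ H₂ γ₀, ∃ S₀ : Finset (HeightOneSpectrum (𝓞 ↥(maximalRealSubfield L))),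
      UnitaryGroup.IsNormalisedOff L 3 H₂ mq p.adele S₀)
    (T : UnitaryGroup.PureTensor L 3 H₂) (hT : T.IsTest) :
    (MatchingAdeleG₂.classes L H₁ H₂ γ₀ ∩
      support fun δ => classOrbitalIntegral (UnitaryGroup.OrbitalMeasureFamily.ofLocalAdelic L 3 H₂ mq mqi) T.eval δ).Finite := by
  -- the relation at the correspondent `γ` (conjugate to `γ₀` in `GL_3(L)`), semisimplicity of `γ`
  have hγab' := mul_sub_smul_mul_sub_smul_eq_zero_of_isConj hγ hγab
  have hss : IsSemisimpleElt (cmConjRingHom L) H₂ γ := isSemisimple_toLin'_of_mul_sub_eq_zero hab hγab'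
  exact MatchingAdeleG₂.finite_classes_inter_support_classOrbitalIntegral_ofLocalAdelic_of_eventuallyKConj' hH₂ hdet hγ
    (MatchingAdeleG₂.eventuallyKConj_rel_of_isSemisimpleElt hH₂ hdet hγ hss) mq mqi hadm hadmA
    (fun v => UnitaryGroup.isClosed_conjClass_localGL_of_mul_sub_eq_zero 3 v _ (isUnit_algebraMap_localRing_sub v hab)
      (mul_sub_smul_toLocal_toAdelic_eq_zero v γ hγab'))
    (UnitaryGroup.isClosed_conjClass_mixedSpaceGL_of_mul_sub_eq_zero L 3 _ (isUnit_mixedEmbedding_sub hab)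
      (mul_sub_smul_cmRationalToArch_eq_zero γ hγab'))
    hnormγ hnorm T hT

end Semisimple

end Literature.NumberTheory.Rogawski1990

end
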